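import Literature.Probability.RandomPlanarGeometry.BrownianStrongMarkov
import Literature.Probability.Process.OptionalHitting
import HarnessLib

/-!
# The strong Markov property of Brownian motion at optional times

Topic `Probability/RandomPlanarGeometry`; theorems only. `BrownianStrongMarkov.lean` proves the
strong Markov property of the canonical Brownian motion `B` (pre-Wiener space, raw natural
filtration `𝓕ᵂ = brownianFiltration`) at stopping times of the RAW filtration: `{τ ≤ t} ∈ 𝓕ᵂ_t`.
Hitting times of closed sets by processes which are only almost surely continuous, or only almost
everywhere defined (the SLE trace), are not raw stopping times; they are (a.s. equal to)
**optional times** — stopping times of the right-continuous regularisation `𝓕ᵂ₊`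
(`MeasureTheory.Filtration.rightCont`; `Literature.Probability.Process.isOptionalTime_iff_isStoppingTime_rightCont`).
This file extends the strong Markov property verbatim to `𝓕ᵂ₊`-stopping times `τ` and events /
random variables of the σ-algebra `𝓕ᵂ_{τ+}` (Mathlib's `IsStoppingTime.measurableSpace` for the
filtration `𝓕ᵂ₊`), which is the generality of Le Gall (2016), Thm. 2.20 ("`(𝓕ₜ)` may be replaced
by `(𝓕ₜ₊)`", Remark after Thm. 2.20; Mörters–Peres (2010), Thm. 2.16, is stated for `𝓕⁺`):

* `setIntegral_comp_brownianIncrAfter_rightCont` — `E[G(Z^τ); A ∩ {τ < ∞}] = E[G(B)] P[A ∩ {τ < ∞}]`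
  for `G` bounded, measurable and continuous in the product topology: the dyadic approximations
  `τₙ = dyadicCeilTop n τ ↓ τ` are RAW stopping times with countable range and
  `𝓕ᵂ_{τ+} ⊆ 𝓕ᵂ_{τₙ}` (`Literature.Probability.Process.measurableSet_dyadicCeilTop_of_rightCont`), so the
  countable case `setIntegral_comp_brownianIncrAfter_of_countable_range` applies to each `τₙ`;
  then dominated convergence along the continuity of paths — Le Gall's proof as printed;
* `map_brownianIncrAfter_restrict_eq_rightCont`, `measure_brownianIncrAfter_mem_inter_rightCont` —
  the law of `Z^τ = B_{τ+·} - B_τ` on `A ∩ {τ < ∞}` is `P[A ∩ {τ < ∞}] · law(B)`;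
* `map_pair_restrict_eq_prod_rightCont`, `setIntegral_brownianIncrAfter_eq_setIntegral_integral_rightCont`
  — product structure of `(X, Z^τ)` on `A ∩ {τ < ∞}` for `X` `𝓕ᵂ_{τ+}`-measurable, and the
  **freezing formula** `E[F(X, Z^τ); A, τ < ∞] = E[E_{ω'}[F(X(ω), B(ω'))]; A, τ < ∞]`.

The proofs are those of `BrownianStrongMarkov.lean` / `SLETraceStrongMarkov.lean` with the
raw-filtration inputs replaced by the two facts above; nothing else changes.

## References

* J.-F. Le Gall, *Brownian Motion, Martingales, and Stochastic Calculus* (2016), Thm. 2.20 and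
  the remark following it; Prop. 3.8.
* P. Mörters, Y. Peres, *Brownian Motion* (2010), Thm. 2.16 (strong Markov property for `𝓕⁺`).
* D. Revuz, M. Yor, *Continuous Martingales and Brownian Motion* (1999), Ch. III, Thm. (3.1).
-/

noncomputable section

open MeasureTheory ProbabilityTheory Filter Set Function
open scoped NNReal ENNReal Topology

namespace Literature.Probability.RandomPlanarGeometry

open Literature.Probability.Process

variable {τ : (ℝ≥0 → ℝ) → WithTop ℝ≥0}

/-- The event `{τ < ∞}` of a `𝓕ᵂ₊`-stopping time is measurable. [folklore] -/
theorem measurableSet_ne_top_rightCont (hτ : IsStoppingTime brownianFiltration.rightCont τ) :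
    MeasurableSet {ω | τ ω ≠ ⊤} :=
  hτ.measurableSet_eq_top.compl

/-- An event of `𝓕ᵂ_{τ+}`, intersected with `{τ < ∞}`, is measurable. [folklore] -/
theorem measurableSet_inter_ne_top_rightCont (hτ : IsStoppingTime brownianFiltration.rightCont τ)
    {A : Set (ℝ≥0 → ℝ)} (hA : MeasurableSet[hτ.measurableSpace] A) :
    MeasurableSet (A ∩ {ω | τ ω ≠ ⊤}) :=
  hA.1.inter (measurableSet_ne_top_rightCont hτ)

/-- **Strong Markov property at an optional time, integrated form** (Le Gall (2016), Thm. 2.20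
with `(𝓕ₜ₊)`). For a stopping time `τ` of `𝓕ᵂ₊`, `A ∈ 𝓕ᵂ_{τ+}`, and a functional `G` of the path
which is bounded, measurable for the product σ-algebra and continuous for the product topology,
`E[G(Z^τ); A ∩ {τ < ∞}] = E[G(B)] · P[A ∩ {τ < ∞}]`, `Z^τ_u = B_{τ+u} - B_τ`: the dyadic
approximations `τₙ ↓ τ` are raw stopping times with countable range and `A ∈ 𝓕ᵂ_{τₙ}`
(`measurableSet_dyadicCeilTop_of_rightCont`), so the countable raw case applies to each `τₙ`; then
`Z^{τₙ} → Z^τ` pointwise by continuity of the paths, and dominated convergence.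
[cite: Legall2016, Thm. 2.20] -/
theorem setIntegral_comp_brownianIncrAfter_rightCont
    (hτ : IsStoppingTime brownianFiltration.rightCont τ) {A : Set (ℝ≥0 → ℝ)}
    (hA : MeasurableSet[hτ.measurableSpace] A) {G : (ℝ≥0 → ℝ) → ℝ} (hGm : Measurable G)
    (hGc : Continuous G) {C : ℝ} (hGb : ∀ w, |G w| ≤ C) :
    ∫ ω in A ∩ {ω | τ ω ≠ ⊤}, G (fun u ↦ brownianIncrAfter τ u ω) ∂Process.preWienerMeasure =
      (∫ ω, G (fun u ↦ Process.brownian u ω) ∂Process.preWienerMeasure) *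
        Process.preWienerMeasure.real (A ∩ {ω | τ ω ≠ ⊤}) := by
  haveI := isProbabilityMeasure_preWienerMeasure'
  set τn : ℕ → (ℝ≥0 → ℝ) → WithTop ℝ≥0 := fun n ω ↦ dyadicCeilTop n (τ ω) with hτndef
  have hτn : ∀ n, IsStoppingTime brownianFiltration (τn n) := fun n ↦
    isStoppingTime_dyadicCeilTop_of_rightCont hτ n
  have hcount : ∀ n, (Set.range (τn n)).Countable := fun n ↦
    (countable_range_dyadicCeilTop n).mono (Set.range_comp_subset_range τ (dyadicCeilTop n))
  have hAn : ∀ n, MeasurableSet[(hτn n).measurableSpace] A := fun n ↦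
    measurableSet_dyadicCeilTop_of_rightCont hτ hA n
  have hset : ∀ n, A ∩ {ω | τn n ω ≠ ⊤} = A ∩ {ω | τ ω ≠ ⊤} := by
    intro n
    ext ω
    simp only [Set.mem_inter_iff, Set.mem_setOf_eq, hτndef, and_congr_right_iff]
    intro _
    induction τ ω using WithTop.recTopCoe with
    | top => simp
    | coe r => simp only [dyadicCeilTop_coe, ne_eq, WithTop.coe_ne_top, not_false_eq_true]
  have hAm : MeasurableSet (A ∩ {ω | τ ω ≠ ⊤}) := measurableSet_inter_ne_top_rightCont hτ hA
  set K : ℝ := ∫ ω, G (fun u ↦ Process.brownian u ω) ∂Process.preWienerMeasure with hK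
  -- the identity for each `τₙ` (raw stopping times with countable range)
  have hn : ∀ n, ∫ ω in A ∩ {ω | τ ω ≠ ⊤}, G (fun u ↦ brownianIncrAfter (τn n) u ω)
      ∂Process.preWienerMeasure = K * Process.preWienerMeasure.real (A ∩ {ω | τ ω ≠ ⊤}) := by
    intro n
    rw [← hset n]
    exact setIntegral_comp_brownianIncrAfter_of_countable_range (hτn n) (hcount n) (hAn n) hGm hGb
  -- pointwise convergence on `{τ < ∞}`
  have hptw : ∀ ω, τ ω ≠ ⊤ → Tendsto (fun n ↦ G (fun u ↦ brownianIncrAfter (τn n) u ω)) atTop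
      (𝓝 (G (fun u ↦ brownianIncrAfter τ u ω))) := by
    intro ω hω
    obtain ⟨r, hr⟩ := WithTop.ne_top_iff_exists.1 hω
    refine (hGc.tendsto _).comp ?_
    rw [tendsto_pi_nhds]
    intro u
    have h1 : ∀ n, brownianIncrAfter (τn n) u ω =
        Process.brownian (dyadicCeil n r + u) ω - Process.brownian (dyadicCeil n r) ω :=
      fun n ↦ brownianIncrAfter_of_eq_coe (by simp only [hτndef, ← hr, dyadicCeilTop_coe]) u
    have h2 : brownianIncrAfter τ u ω = Process.brownian (r + u) ω - Process.brownian r ω :=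
      brownianIncrAfter_of_eq_coe hr.symm u
    simp_rw [h1, h2]
    have hc := Process.continuous_brownian ω
    exact ((hc.tendsto _).comp ((tendsto_dyadicCeil r).add tendsto_const_nhds)).sub
      ((hc.tendsto _).comp (tendsto_dyadicCeil r))
  -- dominated convergence
  have hlim : Tendsto (fun n ↦ ∫ ω in A ∩ {ω | τ ω ≠ ⊤},
      G (fun u ↦ brownianIncrAfter (τn n) u ω) ∂Process.preWienerMeasure) atTop
      (𝓝 (∫ ω in A ∩ {ω | τ ω ≠ ⊤}, G (fun u ↦ brownianIncrAfter τ u ω)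
        ∂Process.preWienerMeasure)) := by
    refine tendsto_integral_of_dominated_convergence (fun _ ↦ C) (fun n ↦ ?_) (integrable_const C)
      (fun n ↦ Eventually.of_forall fun ω ↦ by rw [Real.norm_eq_abs]; exact hGb _) ?_
    · exact (hGm.comp (measurable_brownianIncrAfter_pi (hτn n).measurable')).aestronglyMeasurable
    · rw [ae_restrict_iff' hAm]
      exact Eventually.of_forall fun ω hω ↦ hptw ω hω.2
  have hconst : Tendsto (fun n ↦ ∫ ω in A ∩ {ω | τ ω ≠ ⊤},
      G (fun u ↦ brownianIncrAfter (τn n) u ω) ∂Process.preWienerMeasure) atTop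
      (𝓝 (K * Process.preWienerMeasure.real (A ∩ {ω | τ ω ≠ ⊤}))) := by
    simp_rw [hn]
    exact tendsto_const_nhds
  exact tendsto_nhds_unique hlim hconst

/-- **Strong Markov property at an optional time, measure form.** For a stopping time `τ` of
`𝓕ᵂ₊` and `A ∈ 𝓕ᵂ_{τ+}`, the image of `P` restricted to `A ∩ {τ < ∞}` under
`Z^τ = B_{τ+·} - B_τ` is `P[A ∩ {τ < ∞}]` times the law of the Brownian path (product
σ-algebra): equal finite-dimensional marginals (`setIntegral_comp_brownianIncrAfter_rightCont`,
bounded continuous test functions) and `IsProjectiveLimit.unique`. [cite: Legall2016, Thm. 2.20] -/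
theorem map_brownianIncrAfter_restrict_eq_rightCont
    (hτ : IsStoppingTime brownianFiltration.rightCont τ) {A : Set (ℝ≥0 → ℝ)}
    (hA : MeasurableSet[hτ.measurableSpace] A) :
    (Process.preWienerMeasure.restrict (A ∩ {ω | τ ω ≠ ⊤})).map
        (fun ω u ↦ brownianIncrAfter τ u ω) =
      Process.preWienerMeasure (A ∩ {ω | τ ω ≠ ⊤}) •
        Process.preWienerMeasure.map (fun ω u ↦ Process.brownian u ω) := by
  haveI := isProbabilityMeasure_preWienerMeasure'
  set c : ℝ≥0∞ := Process.preWienerMeasure (A ∩ {ω | τ ω ≠ ⊤}) with hc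
  set Z : (ℝ≥0 → ℝ) → ℝ≥0 → ℝ := fun ω u ↦ brownianIncrAfter τ u ω with hZ
  have hZm : Measurable Z := measurable_brownianIncrAfter_pi hτ.measurable'
  set μ₁ : Measure (ℝ≥0 → ℝ) := (Process.preWienerMeasure.restrict (A ∩ {ω | τ ω ≠ ⊤})).map Z
    with hμ₁
  set μ₂ : Measure (ℝ≥0 → ℝ) :=
    c • Process.preWienerMeasure.map (fun ω u ↦ Process.brownian u ω) with hμ₂
  haveI hPB : IsProbabilityMeasure
      (Process.preWienerMeasure.map (fun (ω : ℝ≥0 → ℝ) (u : ℝ≥0) ↦ Process.brownian u ω)) :=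
    Measure.isProbabilityMeasure_map measurable_brownian_pi.aemeasurable
  haveI : IsFiniteMeasure μ₂ := by
    refine ⟨?_⟩
    rw [hμ₂, Measure.smul_apply, measure_univ, smul_eq_mul, mul_one]
    exact measure_lt_top _ _
  have hfdd : ∀ I : Finset ℝ≥0, μ₁.map I.restrict = μ₂.map I.restrict := by
    intro I
    apply ext_of_forall_integral_eq_of_IsFiniteMeasure
    intro f
    have hfm : Measurable fun w : ℝ≥0 → ℝ ↦ f (I.restrict w) :=
      f.continuous.measurable.comp (Finset.measurable_restrict I)
    have hfb : ∀ w : ℝ≥0 → ℝ, |f (I.restrict w)| ≤ ‖f‖ := fun w ↦ by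
      rw [← Real.norm_eq_abs]; exact f.norm_coe_le_norm _
    rw [integral_map (Finset.measurable_restrict I).aemeasurable f.continuous.aestronglyMeasurable,
      integral_map (Finset.measurable_restrict I).aemeasurable f.continuous.aestronglyMeasurable,
      hμ₁, integral_map hZm.aemeasurable hfm.aestronglyMeasurable, hμ₂, integral_smul_measure,
      integral_map measurable_brownian_pi.aemeasurable hfm.aestronglyMeasurable]
    rw [setIntegral_comp_brownianIncrAfter_rightCont hτ hA hfm
      (f.continuous.comp (continuous_finsetRestrict I)) hfb]
    rw [measureReal_def, ← hc, smul_eq_mul, mul_comm]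
  have h₁ : IsProjectiveLimit μ₁ (fun I : Finset ℝ≥0 ↦ μ₁.map I.restrict) := fun _ ↦ rfl
  have h₂ : IsProjectiveLimit μ₂ (fun I : Finset ℝ≥0 ↦ μ₁.map I.restrict) := fun I ↦ (hfdd I).symm
  exact h₁.unique h₂

/-- **Strong Markov property at an optional time, for events.** For a stopping time `τ` of
`𝓕ᵂ₊`, `A ∈ 𝓕ᵂ_{τ+}` and a measurable set `S` of paths,
`P[Z^τ ∈ S, A, τ < ∞] = P[B ∈ S] · P[A, τ < ∞]`. [cite: Legall2016, Thm. 2.20] -/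
theorem measure_brownianIncrAfter_mem_inter_rightCont
    (hτ : IsStoppingTime brownianFiltration.rightCont τ) {A : Set (ℝ≥0 → ℝ)}
    (hA : MeasurableSet[hτ.measurableSpace] A) {S : Set (ℝ≥0 → ℝ)} (hS : MeasurableSet S) :
    Process.preWienerMeasure
        ((fun ω u ↦ brownianIncrAfter τ u ω) ⁻¹' S ∩ (A ∩ {ω | τ ω ≠ ⊤})) =
      Process.preWienerMeasure ((fun ω u ↦ Process.brownian u ω) ⁻¹' S) *
        Process.preWienerMeasure (A ∩ {ω | τ ω ≠ ⊤}) := by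
  have hZm : Measurable fun (ω : ℝ≥0 → ℝ) (u : ℝ≥0) ↦ brownianIncrAfter τ u ω :=
    measurable_brownianIncrAfter_pi hτ.measurable'
  have h := congrArg (fun μ : Measure (ℝ≥0 → ℝ) ↦ μ S)
    (map_brownianIncrAfter_restrict_eq_rightCont hτ hA)
  rw [Measure.map_apply hZm hS, Measure.restrict_apply (hZm hS), Measure.smul_apply,
    Measure.map_apply measurable_brownian_pi hS, smul_eq_mul] at h
  rw [h, mul_comm]

/-! ### The freezing formula at an optional time, restricted to `A ∩ {τ < ∞}` -/

section Freezing

variable {𝒳 : Type*} [MeasurableSpace 𝒳]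

/-- **Product structure on `A ∩ {τ < ∞}` at an optional time**: for `A ∈ 𝓕ᵂ_{τ+}` and `X`
`𝓕ᵂ_{τ+}`-measurable, the image of `P|_{A ∩ {τ<∞}}` under `(X, Z^τ)` is the product of the image
of `P|_{A ∩ {τ<∞}}` under `X` with the law of the Brownian path (rectangles:
`measure_brownianIncrAfter_mem_inter_rightCont` with the event `A ∩ X⁻¹U ∈ 𝓕ᵂ_{τ+}`; then
`Measure.prod_eq`). [cite: Legall2016, Thm. 2.20] -/
theorem map_pair_restrict_eq_prod_rightCont (hτ : IsStoppingTime brownianFiltration.rightCont τ)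
    {X : (ℝ≥0 → ℝ) → 𝒳} (hX : Measurable[hτ.measurableSpace] X) {A : Set (ℝ≥0 → ℝ)}
    (hA : MeasurableSet[hτ.measurableSpace] A) :
    (Process.preWienerMeasure.restrict (A ∩ {ω | τ ω ≠ ⊤})).map
        (fun ω ↦ (X ω, fun u ↦ brownianIncrAfter τ u ω)) =
      ((Process.preWienerMeasure.restrict (A ∩ {ω | τ ω ≠ ⊤})).map X).prod
        (Process.preWienerMeasure.map fun ω u ↦ Process.brownian u ω) := by
  haveI := isProbabilityMeasure_preWienerMeasure'
  set ν := Process.preWienerMeasure.restrict (A ∩ {ω | τ ω ≠ ⊤}) with hν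
  have hZm : Measurable fun (ω : ℝ≥0 → ℝ) (u : ℝ≥0) ↦ brownianIncrAfter τ u ω :=
    measurable_brownianIncrAfter_pi hτ.measurable'
  have hXm : Measurable X := hX.mono hτ.measurableSpace_le le_rfl
  have hAm : MeasurableSet (A ∩ {ω | τ ω ≠ ⊤}) := measurableSet_inter_ne_top_rightCont hτ hA
  haveI : IsFiniteMeasure ν := by rw [hν]; infer_instance
  haveI : IsFiniteMeasure (ν.map X) := Measure.isFiniteMeasure_map _ _
  haveI : IsProbabilityMeasure (Process.preWienerMeasure.map
      fun (ω : ℝ≥0 → ℝ) (u : ℝ≥0) ↦ Process.brownian u ω) :=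
    Measure.isProbabilityMeasure_map measurable_brownian_pi.aemeasurable
  symm
  refine Measure.prod_eq fun U S hU hS ↦ ?_
  rw [Measure.map_apply (hXm.prodMk hZm) (hU.prod hS), Measure.map_apply hXm hU,
    Measure.map_apply measurable_brownian_pi hS, hν, Measure.restrict_apply (hXm hU),
    Measure.restrict_apply ((hXm.prodMk hZm) (hU.prod hS))]
  have hA' : MeasurableSet[hτ.measurableSpace] (A ∩ X ⁻¹' U) := hA.inter (hX hU)
  have h := measure_brownianIncrAfter_mem_inter_rightCont hτ hA' hS
  have hset : (fun ω ↦ (X ω, fun u ↦ brownianIncrAfter τ u ω)) ⁻¹' U ×ˢ S ∩ (A ∩ {ω | τ ω ≠ ⊤}) =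
      (fun ω u ↦ brownianIncrAfter τ u ω) ⁻¹' S ∩ (A ∩ X ⁻¹' U ∩ {ω | τ ω ≠ ⊤}) := by
    ext ω; simp only [mem_inter_iff, mem_preimage, mem_prod, mem_setOf_eq]; tauto
  have hset' : X ⁻¹' U ∩ (A ∩ {ω | τ ω ≠ ⊤}) = A ∩ X ⁻¹' U ∩ {ω | τ ω ≠ ⊤} := by
    ext ω; simp only [mem_inter_iff, mem_preimage, mem_setOf_eq]; tauto
  rw [hset, h, hset', mul_comm]

/-- **Freezing formula for the increments after an optional time, restricted to `A ∩ {τ < ∞}`**: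
for a stopping time `τ` of `𝓕ᵂ₊`, `A ∈ 𝓕ᵂ_{τ+}`, `X` `𝓕ᵂ_{τ+}`-measurable and `F` bounded
jointly measurable, `E[F(X, Z^τ); A, τ < ∞] = E[ E_{ω'}[F(X(ω), B(ω'))] ; A, τ < ∞]`.
Le Gall (2016), Thm. 2.20 with `(𝓕ₜ₊)`. [cite: Legall2016, Thm. 2.20] -/
theorem setIntegral_brownianIncrAfter_eq_setIntegral_integral_rightCont
    (hτ : IsStoppingTime brownianFiltration.rightCont τ)
    {X : (ℝ≥0 → ℝ) → 𝒳} (hX : Measurable[hτ.measurableSpace] X) {F : 𝒳 → (ℝ≥0 → ℝ) → ℝ}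
    (hFm : Measurable (Function.uncurry F)) {C : ℝ} (hFb : ∀ x w, |F x w| ≤ C) {A : Set (ℝ≥0 → ℝ)}
    (hA : MeasurableSet[hτ.measurableSpace] A) :
    ∫ ω in A ∩ {ω | τ ω ≠ ⊤}, F (X ω) (fun u ↦ brownianIncrAfter τ u ω) ∂Process.preWienerMeasure =
      ∫ ω in A ∩ {ω | τ ω ≠ ⊤}, (∫ ω', F (X ω) (fun u ↦ Process.brownian u ω')
        ∂Process.preWienerMeasure) ∂Process.preWienerMeasure := by
  haveI := isProbabilityMeasure_preWienerMeasure'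
  set ν := Process.preWienerMeasure.restrict (A ∩ {ω | τ ω ≠ ⊤}) with hν
  set Z : (ℝ≥0 → ℝ) → ℝ≥0 → ℝ := fun ω u ↦ brownianIncrAfter τ u ω with hZ
  have hZm : Measurable Z := measurable_brownianIncrAfter_pi hτ.measurable'
  have hXm : Measurable X := hX.mono hτ.measurableSpace_le le_rfl
  haveI : IsFiniteMeasure ν := by rw [hν]; infer_instance
  haveI : IsFiniteMeasure (ν.map X) := Measure.isFiniteMeasure_map _ _
  haveI : IsProbabilityMeasure (Process.preWienerMeasure.map
      fun (ω : ℝ≥0 → ℝ) (u : ℝ≥0) ↦ Process.brownian u ω) :=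
    Measure.isProbabilityMeasure_map measurable_brownian_pi.aemeasurable
  have hFint : ∀ (μ : Measure (𝒳 × (ℝ≥0 → ℝ))) [IsFiniteMeasure μ],
      Integrable (Function.uncurry F) μ := fun μ _ ↦
    (integrable_const C).mono' hFm.aestronglyMeasurable (Eventually.of_forall fun p ↦ by
      rw [Real.norm_eq_abs]; exact hFb p.1 p.2)
  have hpair := map_pair_restrict_eq_prod_rightCont hτ hX hA
  have h1 : ∫ ω, F (X ω) (Z ω) ∂ν = ∫ p, Function.uncurry F p ∂(ν.map fun ω ↦ (X ω, Z ω)) := by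
    rw [integral_map (hXm.prodMk hZm).aemeasurable hFm.aestronglyMeasurable]
    rfl
  change ∫ ω, F (X ω) (Z ω) ∂ν =
    ∫ ω, (∫ ω', F (X ω) (fun u ↦ Process.brownian u ω') ∂Process.preWienerMeasure) ∂ν
  rw [h1, hpair, integral_prod _ (hFint _)]
  have h3 : ∀ x : 𝒳, ∫ w, Function.uncurry F (x, w)
      ∂(Process.preWienerMeasure.map fun ω u ↦ Process.brownian u ω) =
      ∫ ω', F x (fun u ↦ Process.brownian u ω') ∂Process.preWienerMeasure := fun x ↦ by
    rw [integral_map measurable_brownian_pi.aemeasurable]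
    · rfl
    · exact (hFm.comp (measurable_const.prodMk measurable_id)).aestronglyMeasurable
  simp_rw [h3]
  rw [integral_map hXm.aemeasurable]
  refine (Measurable.stronglyMeasurable ?_).aestronglyMeasurable
  exact (hFm.comp (measurable_fst.prodMk (measurable_brownian_pi.comp
    measurable_snd))).stronglyMeasurable.integral_prod_right' |>.measurable

end Freezing

/-! ### The frozen past: the stopped path and the time -/

/-- **The Brownian path stopped at an optional time is `𝓕ᵂ_{τ+}`-measurable**: for every `u`,
`ω ↦ B_{u ∧ τ}(ω)` (Mathlib `stoppedProcess`) is measurable with respect to `𝓕ᵂ_{τ+}` (the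
Brownian motion is continuous and adapted to `𝓕ᵂ ≤ 𝓕ᵂ₊`, hence progressively measurable for
`𝓕ᵂ₊`; Mathlib `measurable_stoppedValue`). Le Gall (2016), Thm. 3.7 / Prop. 3.9.
[cite: Legall2016, Thm. 3.7] -/
theorem measurable_stoppedProcess_brownian_rightCont
    (hτ : IsStoppingTime brownianFiltration.rightCont τ) (u : ℝ≥0) :
    Measurable[hτ.measurableSpace] (stoppedProcess Process.brownian τ u) := by
  have hprog : IsStronglyProgressive brownianFiltration.rightCont Process.brownian :=
    StronglyAdapted.isStronglyProgressive_of_continuous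
      (fun t ↦ (stronglyAdapted_brownian t).mono (brownianFiltration.le_rightCont t))
      fun ω ↦ Process.continuous_brownian ω
  have h := measurable_stoppedValue (β := ℝ) hprog (hτ.min_const u)
  have hle : (hτ.min_const u).measurableSpace ≤ hτ.measurableSpace :=
    IsStoppingTime.measurableSpace_mono _ hτ fun ω ↦ min_le_left _ _
  have heq : (stoppedValue Process.brownian fun ω ↦ min (τ ω) u) =
      stoppedProcess Process.brownian τ u := by
    rw [stoppedProcess_eq_stoppedValue]
    simp_rw [min_comm]
  rw [← heq]
  exact h.mono hle le_rfl

end Literature.Probability.RandomPlanarGeometry
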